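import Literature.NumberTheory.Rogawski1990.ArchBouazizClassMapG      -- ★ F0 (LH3-p04 (g7)): `bzClassMapG`, `esymm3`, `chartEigG_of_mem ∕ _of_not_mem`, `bzClassMapG_congr`
import Literature.NumberTheory.Rogawski1990.ArchBouazizClassRangeG    -- ★ p851972 (F0P3a-p04 (g27)): `isClosed_range_esymm_boostEig`, `isClosed_range_esymm_circle` (the per-place cores)
import HarnessLib

/-!
# (7) F2 — THE CLASS IMAGE OF A `G`-CHART IS CLOSED: `IsClosed (Set.range (bzClassMapG S′))` (Bouaziz 1994 §2.3, §5.1; Rogawski 1990 §3.6, §8.2)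

Topic `NumberTheory/Rogawski1990`; namespace `Literature.NumberTheory.Rogawski1990`.  THEOREMS ONLY (no `def`, no instance, no notation, no axiom, no named fact, no `sorry`).
Cell `pub/hodgecm-mathlib`, crux H413 (`stmt-HodgeConjecture-24833`), road «N8-INNER» (row 2 `stub_N8`), brick (7) «(Σ-REG-G)» (owner LH3-p04 (g7)), file **F2** (dealer LH2-plan (g1)
DEAL 2026-09-02T15:59:55Z → LH10-p02 (g9)); the `G`-twin of ★ `ArchBouazizClassMapClosedRange` (F0P3a-p09 (g8)): the set of class data of the chart `S′`, `Set.range (bzClassMapG S′)`,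
is CLOSED in `W → ℂ × ℂ × ℂ`, so a base class OFF the image of a chart type is at positive distance from it (the «wrong chart type sees nothing near `b`» step of the regular-germ
assembly F7, `a := 0` branch).  Count-neutral.

THE MATHEMATICS (group-free, any `[Fintype W] [DecidableEq W]`).  ★ `bzClassMapG S′ c w = esymm3 (chartEigG S′ c w)` reads the place `w` only through `c w` (★ `bzClassMapG_congr`),
so its range is the PRODUCT over the places of the per-place ranges (§2 `range_bzClassMapG_eq_pi`; Mathlib `isClosed_set_pi`).  Per place the ranges are closed by ★ p851972: at a
noncompact place `w ∈ S′` the symmetric data of ★ `boostEig t` have closed range (★ `isClosed_range_esymm_boostEig`: proper in `x`), at a compact place the symmetric data of the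
unit triple have compact range (★ `isClosed_range_esymm_circle`: image of the torus) — §1 rewrites `bzClassMapG S′ (fun _ => t) w` into those two shapes (`rfl` on ★ `esymm3`).
HONEST LABEL: topology bookkeeping for (7); HC_CM is proved only modulo the 7 printed citations (2 remaining: hLiu418 = stmt-HodgeConjecture-24832, h413 = stmt-HodgeConjecture-24833)
until rung 0 closes; this file moves no row of the books.

## References
* [Bouaziz1994IntegralesOrbitales] A. Bouaziz, *Intégrales orbitales sur les groupes de Lie réductifs*, Ann. Sci. ÉNS (4) 27 (1994) 573–609, §2.3 Lemme 2.3.1, §5.1 p. 588.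
* [Rogawski1990] J. D. Rogawski, *Automorphic Representations of Unitary Groups in Three Variables*, Ann. of Math. Stud. 123 (1990), §3.6 p. 31; §8.2 p. 122.
-/

set_option autoImplicit false

noncomputable section

open Complex Set Function
open Literature.NumberTheory.Automorphic Literature.NumberTheory.Automorphic.UnitaryGroup Literature.NumberTheory.Automorphic.ArchCartan

namespace Literature.NumberTheory.Rogawski1990

variable {W : Type*} [DecidableEq W]

/-! ## §1 The per-place ranges are closed -/

/-- **NONCOMPACT PLACE: the per-place class range is CLOSED** (★ `isClosed_range_esymm_boostEig`). [cite: Bouaziz1994IntegralesOrbitales, §5.1 p. 588] [cite: Rogawski1990, §3.6 p. 31] -/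
theorem isClosed_range_bzClassMapG_const_of_mem {S' : Finset W} {w : W} (hw : w ∈ S') :
    IsClosed (Set.range fun t : Fin 3 → ℝ => bzClassMapG S' (fun _ : W => t) w) := by
  have hfun : (fun t : Fin 3 → ℝ => bzClassMapG S' (fun _ : W => t) w) = fun t : Fin 3 → ℝ =>
      (boostEig t 0 + boostEig t 1 + boostEig t 2, boostEig t 0 * boostEig t 1 + boostEig t 0 * boostEig t 2 + boostEig t 1 * boostEig t 2, boostEig t 0 * boostEig t 1 * boostEig t 2) := by
    funext t
    rw [bzClassMapG_apply, chartEigG_of_mem hw]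
    rfl
  rw [hfun]
  exact isClosed_range_esymm_boostEig

/-- **COMPACT PLACE: the per-place class range is CLOSED** (compact: ★ `isClosed_range_esymm_circle`). [cite: Rogawski1990, §8.2 p. 122] [cite: Bouaziz1994IntegralesOrbitales, §5.1 p. 588] -/
theorem isClosed_range_bzClassMapG_const_of_not_mem {S' : Finset W} {w : W} (hw : w ∉ S') :
    IsClosed (Set.range fun t : Fin 3 → ℝ => bzClassMapG S' (fun _ : W => t) w) := by
  have hfun : (fun t : Fin 3 → ℝ => bzClassMapG S' (fun _ : W => t) w) = fun t : Fin 3 → ℝ =>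
      (Complex.exp ((t 0 : ℂ) * I) + Complex.exp ((t 1 : ℂ) * I) + Complex.exp ((t 2 : ℂ) * I),
        Complex.exp ((t 0 : ℂ) * I) * Complex.exp ((t 1 : ℂ) * I) + Complex.exp ((t 0 : ℂ) * I) * Complex.exp ((t 2 : ℂ) * I) + Complex.exp ((t 1 : ℂ) * I) * Complex.exp ((t 2 : ℂ) * I),
        Complex.exp ((t 0 : ℂ) * I) * Complex.exp ((t 1 : ℂ) * I) * Complex.exp ((t 2 : ℂ) * I)) := by
    funext t
    rw [bzClassMapG_apply, chartEigG_of_not_mem hw]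
    rfl
  rw [hfun]
  exact isClosed_range_esymm_circle

/-- Either way the per-place class range is closed. [cite: Bouaziz1994IntegralesOrbitales, §5.1 p. 588] -/
theorem isClosed_range_bzClassMapG_const (S' : Finset W) (w : W) :
    IsClosed (Set.range fun t : Fin 3 → ℝ => bzClassMapG S' (fun _ : W => t) w) := by
  by_cases hw : w ∈ S'
  · exact isClosed_range_bzClassMapG_const_of_mem hw
  · exact isClosed_range_bzClassMapG_const_of_not_mem hw

/-! ## §2 The range of the class map is the product of the per-place ranges, hence closed -/

/-- **The class image of the chart `S′` is the PRODUCT of the per-place ranges** (the class map reads `w` only through `c w`, ★ `bzClassMapG_congr`).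
[cite: Bouaziz1994IntegralesOrbitales, §2.3 p. 578; §5.1 p. 588] -/
theorem range_bzClassMapG_eq_pi (S' : Finset W) :
    Set.range (bzClassMapG S') = Set.pi Set.univ fun w : W => Set.range fun t : Fin 3 → ℝ => bzClassMapG S' (fun _ : W => t) w := by
  ext F
  simp only [Set.mem_range, Set.mem_pi, Set.mem_univ, forall_const]
  constructor
  · rintro ⟨c, rfl⟩ w
    exact ⟨c w, bzClassMapG_congr S' rfl⟩
  · intro h
    choose t ht using h
    exact ⟨fun w => t w, funext fun w => (bzClassMapG_congr S' (c' := fun _ : W => t w) rfl).trans (ht w)⟩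

/-- **(7) F2 — THE CLASS IMAGE OF A `G`-CHART IS CLOSED**: `Set.range (bzClassMapG S′)` is closed in `W → ℂ × ℂ × ℂ` — product of closed per-place ranges (Mathlib `isClosed_set_pi`; §1).
So a base class off the image of the chart type `S′` is at positive distance from every class datum of that chart (F7's chart-type selection, `a := 0` branch).
[cite: Bouaziz1994IntegralesOrbitales, §2.3 Lemme 2.3.1; §5.1 p. 588] [cite: Rogawski1990, §3.6 p. 31; §8.2 p. 122] -/
theorem isClosed_range_bzClassMapG [Fintype W] (S' : Finset W) : IsClosed (Set.range (bzClassMapG S')) := by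
  rw [range_bzClassMapG_eq_pi]
  exact isClosed_set_pi fun w _ => isClosed_range_bzClassMapG_const S' w

/-- **Positive distance from a closed image**: a class datum `b` NOT in the image of the chart `S′` has an `ε > 0` with NO class datum of `S′` within `ε` (sup metric on `W → ℂ × ℂ × ℂ`).
[cite: Bouaziz1994IntegralesOrbitales, §5.1 p. 588] -/
theorem exists_pos_forall_dist_bzClassMapG_ge [Fintype W] (S' : Finset W) {b : W → ℂ × ℂ × ℂ} (hb : b ∉ Set.range (bzClassMapG S')) :
    ∃ ε > (0 : ℝ), ∀ c : W → Fin 3 → ℝ, ε ≤ dist (bzClassMapG S' c) b := by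
  have hopen : IsOpen (Set.range (bzClassMapG S'))ᶜ := (isClosed_range_bzClassMapG S').isOpen_compl
  obtain ⟨ε, hε, hball⟩ := Metric.isOpen_iff.1 hopen b hb
  refine ⟨ε, hε, fun c => ?_⟩
  by_contra hlt
  push Not at hlt
  have hmem : bzClassMapG S' c ∈ Metric.ball b ε := by rw [Metric.mem_ball]; exact hlt
  exact hball hmem ⟨c, rfl⟩

end Literature.NumberTheory.Rogawski1990

end
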